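import Literature.AlgebraicTopology.Homotopy.FibreBundles
import Mathlib.Topology.LocallyConstant.Basic
import HarnessLib

/-!
# Gluing local trivialisations over a finite clopen partition of the total space; restriction

Topic `Literature/AlgebraicTopology/Homotopy`. Point-set bookkeeping for locally trivial
fibrations in the sense of Bröcker–Jänich (8.12) (`IsLocallyTrivialFibration`: near every point of
the base, `f⁻¹(U) ≃ U × f⁻¹(b)` over `U`), PROVED:

* `exists_homeomorph_sigma_of_isLocallyConstant` — a locally constant map `part : E → ι` splits `E`
  homeomorphically as the disjoint union `Σ i, {part = i}` of its (clopen) level sets;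
* `IsLocallyTrivialFibration.of_isLocallyConstant` — **gluing**: if `E` is partitioned into
  finitely many clopen pieces (the level sets of a locally constant `part : E → ι`, `ι` finite) and
  `f` is a locally trivial fibration on each piece, then `f` is a locally trivial fibration
  (intersect the finitely many trivialising neighbourhoods and take the disjoint union of the
  trivialisations);
* `IsLocallyTrivialFibration.restrict_preimage` — the restriction of a locally trivial fibration
  over an open subset of the base is one;
* `IsLocallyTrivialFibration.comp_homeomorph`, `IsLocallyTrivialFibration.of_comp_homeomorph_base`
  — transport along homeomorphisms of the total space and of the base.

[folklore] (used for the complement of a normal crossings boundary in a family, component by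
component: `Literature/AlgebraicGeometry/HodgeTheory`).

## References

* Th. Bröcker, K. Jänich, *Introduction to Differential Topology* (1982), (8.12). [BrockerJanichIDT1982]
-/

noncomputable section

open Function Set Topology

namespace Literature.AlgebraicTopology.Homotopy

universe u v

variable {E : Type u} {B : Type v} [TopologicalSpace E] [TopologicalSpace B]

/-! ### Disjoint unions -/

/-- **A locally constant map splits its source as the disjoint union of its level sets**:
`(Σ i, {x | part x = i}) ≃ₜ E`, `⟨i, x⟩ ↦ x` (continuous, open since the level sets are open,
bijective). [folklore] -/
theorem exists_homeomorph_sigma_of_isLocallyConstant {ι : Type*} (part : E → ι)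
    (h : IsLocallyConstant part) :
    ∃ e : (Σ i, {x : E // part x = i}) ≃ₜ E, (∀ p, e p = p.2.1) ∧ ∀ x, e.symm x = ⟨part x, x, rfl⟩ := by
  refine ⟨(Equiv.sigmaFiberEquiv part).toHomeomorphOfContinuousOpen ?_ ?_, fun p => rfl, fun x => rfl⟩
  · exact continuous_sigma_iff.2 fun i => continuous_subtype_val
  · refine isOpenMap_sigma.2 fun i => ?_
    exact (h.isOpen_fiber i).isOpenMap_subtype_val

/-- A family of homeomorphisms induces a homeomorphism of disjoint unions. [folklore] -/
theorem exists_homeomorph_sigma_congr {ι : Type*} {α β : ι → Type*} [∀ i, TopologicalSpace (α i)]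
    [∀ i, TopologicalSpace (β i)] (ψ : ∀ i, α i ≃ₜ β i) :
    ∃ e : (Σ i, α i) ≃ₜ Σ i, β i, ∀ p, e p = ⟨p.1, ψ p.1 p.2⟩ := by
  refine ⟨(Equiv.sigmaCongrRight fun i => (ψ i).toEquiv).toHomeomorphOfContinuousOpen ?_ ?_,
    fun p => rfl⟩
  · exact continuous_sigma_iff.2 fun i =>
      (continuous_sigmaMk (σ := β)).comp (ψ i).continuous
  · refine isOpenMap_sigma.2 fun i => ?_
    exact (isOpenMap_sigmaMk (σ := β)).comp (ψ i).isOpenMap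

/-! ### Gluing over a finite clopen partition of the total space -/

/-- **Gluing local trivialisations.** Let `part : E → ι` be locally constant with `ι` finite
(a partition of `E` into finitely many clopen pieces `Eᵢ = {part = i}`) and suppose that `f`
restricted to each piece is a locally trivial fibration. Then `f` is a locally trivial fibration:
about `b`, intersect the finitely many trivialising neighbourhoods `Uᵢ` to `U` and assemble
`U × f⁻¹(b) = ⊔ᵢ U × fᵢ⁻¹(b) ≃ ⊔ᵢ fᵢ⁻¹(U) = f⁻¹(U)`. [folklore] -/
theorem IsLocallyTrivialFibration.of_isLocallyConstant {ι : Type*} [Finite ι] {f : E → B}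
    (part : E → ι) (hpart : IsLocallyConstant part)
    (h : ∀ i, IsLocallyTrivialFibration (fun x : {x : E // part x = i} => f x.1)) :
    IsLocallyTrivialFibration f := by
  classical
  intro b
  choose U hUo hbU φ hφ using fun i => h i b
  haveI : Fintype ι := Fintype.ofFinite ι
  refine ⟨⋂ i, U i, isOpen_iInter_of_finite hUo, mem_iInter.2 hbU, ?_⟩
  set W : Set B := ⋂ i, U i with hW
  have hWU : ∀ i, W ⊆ U i := fun i => iInter_subset _ i
  -- the pieces: `Eᵢ = {part = i}`, `fᵢ = f|Eᵢ`
  -- (1) restricted trivialisations `ψ i : W × fᵢ⁻¹(b) ≃ₜ {x : Eᵢ // f x ∈ W}`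
  have hψ : ∀ i, ∃ ψ : ↥W × ↥((fun x : {x : E // part x = i} => f x.1) ⁻¹' {b}) ≃ₜ
      {x : {x : E // part x = i} // f x.1 ∈ W}, ∀ q, f (ψ q).1.1 = q.1 := by
    intro i
    have hval : ∀ q : ↥W × ↥((fun x : {x : E // part x = i} => f x.1) ⁻¹' {b}),
        f (φ i (⟨q.1.1, hWU i q.1.2⟩, q.2)).1.1 ∈ W := fun q => by
      have h1 := hφ i (⟨q.1.1, hWU i q.1.2⟩, q.2)
      change f (φ i (⟨q.1.1, hWU i q.1.2⟩, q.2)).1.1 = q.1.1 at h1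
      rw [h1]; exact q.1.2
    have hmemU : ∀ x : {x : {x : E // part x = i} // f x.1 ∈ W},
        x.1 ∈ (fun x : {x : E // part x = i} => f x.1) ⁻¹' U i := fun x => hWU i x.2
    have hfst : ∀ x : {x : {x : E // part x = i} // f x.1 ∈ W},
        (((φ i).symm ⟨x.1, hmemU x⟩).1 : B) = f x.1.1 := fun x => by
      have h1 := hφ i ((φ i).symm ⟨x.1, hmemU x⟩)
      rw [Homeomorph.apply_symm_apply] at h1
      exact h1.symm
    refine ⟨{ toFun := fun q => ⟨(φ i (⟨q.1.1, hWU i q.1.2⟩, q.2)).1, hval q⟩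
              invFun := fun x => (⟨((φ i).symm ⟨x.1, hmemU x⟩).1, by rw [hfst]; exact x.2⟩,
                ((φ i).symm ⟨x.1, hmemU x⟩).2)
              left_inv := fun q => by
                obtain ⟨⟨u, hu⟩, e⟩ := q
                simp only [Subtype.coe_eta, Homeomorph.symm_apply_apply]
              right_inv := fun x => by
                apply Subtype.ext
                simp only [Subtype.coe_eta, Prod.mk.eta, Homeomorph.apply_symm_apply]
              continuous_toFun := by
                refine Continuous.subtype_mk (continuous_subtype_val.comp ((φ i).continuous.comp
                  (Continuous.prodMk ?_ continuous_snd))) _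
                exact (continuous_subtype_val.comp continuous_fst).subtype_mk _
              continuous_invFun := by
                have hc : Continuous fun x : {x : {x : E // part x = i} // f x.1 ∈ W} =>
                    (φ i).symm ⟨x.1, hmemU x⟩ :=
                  (φ i).symm.continuous.comp (continuous_subtype_val.subtype_mk _)
                exact ((continuous_subtype_val.comp (continuous_fst.comp hc)).subtype_mk _).prodMk
                  (continuous_snd.comp hc) }, fun q => ?_⟩
    exact hφ i (⟨q.1.1, hWU i q.1.2⟩, q.2)
  choose ψ hψ using hψ
  -- (2) disjoint-union decompositions of the fibre over `b` and of `f⁻¹(W)`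
  obtain ⟨eF, heF, heFs⟩ := exists_homeomorph_sigma_of_isLocallyConstant
    (fun y : ↥(f ⁻¹' {b}) => part y.1) (hpart.comp_continuous continuous_subtype_val)
  obtain ⟨eW, heW, heWs⟩ := exists_homeomorph_sigma_of_isLocallyConstant
    (fun y : ↥(f ⁻¹' W) => part y.1) (hpart.comp_continuous continuous_subtype_val)
  -- reshuffling the two subtype conditions
  have hsh₁ : ∀ i, ∃ s : {y : ↥(f ⁻¹' {b}) // part y.1 = i} ≃ₜ
      ↥((fun x : {x : E // part x = i} => f x.1) ⁻¹' {b}),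
      ∀ y, ((s y).1.1 : E) = y.1.1 := fun i =>
    ⟨{ toFun := fun y => ⟨⟨y.1.1, y.2⟩, y.1.2⟩
       invFun := fun x => ⟨⟨x.1.1, x.2⟩, x.1.2⟩
       left_inv := fun y => rfl
       right_inv := fun x => rfl
       continuous_toFun := ((continuous_subtype_val.comp continuous_subtype_val).subtype_mk _).subtype_mk _
       continuous_invFun := ((continuous_subtype_val.comp continuous_subtype_val).subtype_mk _).subtype_mk _ },
      fun y => rfl⟩
  choose s₁ hs₁ using hsh₁
  have hsh₂ : ∀ i, ∃ s : {x : {x : E // part x = i} // f x.1 ∈ W} ≃ₜ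
      {y : ↥(f ⁻¹' W) // part y.1 = i}, ∀ x, ((s x).1.1 : E) = x.1.1 := fun i =>
    ⟨{ toFun := fun x => ⟨⟨x.1.1, x.2⟩, x.1.2⟩
       invFun := fun y => ⟨⟨y.1.1, y.2⟩, y.1.2⟩
       left_inv := fun x => rfl
       right_inv := fun y => rfl
       continuous_toFun := ((continuous_subtype_val.comp continuous_subtype_val).subtype_mk _).subtype_mk _
       continuous_invFun := ((continuous_subtype_val.comp continuous_subtype_val).subtype_mk _).subtype_mk _ },
      fun x => rfl⟩
  choose s₂ hs₂ using hsh₂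
  -- (3) the piecewise trivialisation `Σ i, Fᵢ × W ≃ₜ Σ i, {y : f⁻¹ W // part y = i}`
  obtain ⟨eS, heS⟩ := exists_homeomorph_sigma_congr fun i =>
    (((Homeomorph.prodComm _ _).trans ((Homeomorph.prodCongr (Homeomorph.refl ↥W) (s₁ i)).trans
      (ψ i))).trans (s₂ i))
  -- (4) assemble `W × f⁻¹(b) ≃ₜ f⁻¹(W)`
  let Φ : ↥W × ↥(f ⁻¹' {b}) ≃ₜ ↥(f ⁻¹' W) :=
    ((((Homeomorph.prodCongr (Homeomorph.refl ↥W) eF.symm).trans (Homeomorph.prodComm _ _)).trans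
      Homeomorph.sigmaProdDistrib).trans eS).trans eW
  refine ⟨Φ, fun q => ?_⟩
  obtain ⟨u, e⟩ := q
  have h1 : (Φ (u, e) : E) = (ψ (part e.1) (u, s₁ (part e.1) ⟨e, rfl⟩)).1.1 := by
    change (eW (eS (Homeomorph.sigmaProdDistrib ((eF.symm e), u))) : E) = _
    rw [heFs, heW, heS]
    exact hs₂ _ _
  change f (Φ (u, e) : E) = u
  rw [h1]
  exact hψ _ _

/-! ### Restriction over an open subset of the base; transport -/

/-- **Restriction**: a locally trivial fibration restricted over an open subset `O` of the base,
`f⁻¹(O) → O`, is a locally trivial fibration. [folklore] -/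
theorem IsLocallyTrivialFibration.restrict_preimage {f : E → B} (hf : IsLocallyTrivialFibration f)
    {O : Set B} (hO : IsOpen O) :
    IsLocallyTrivialFibration (O.restrictPreimage f) := by
  intro b
  obtain ⟨U, hUo, hbU, φ, hφ⟩ := hf b.1
  -- the neighbourhood `U ∩ O`, seen in `O`
  refine ⟨Subtype.val ⁻¹' (U ∩ O), (hUo.inter hO).preimage continuous_subtype_val, ⟨hbU, b.2⟩, ?_⟩
  -- bookkeeping facts
  have key₁ : ∀ e : ↥(f ⁻¹' O), O.restrictPreimage f e ∈ ({b} : Set ↥O) → e.1 ∈ f ⁻¹' ({b.1} : Set B) :=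
    fun e he => congrArg Subtype.val (mem_singleton_iff.1 he)
  have key₂ : ∀ (z : E) (hz : z ∈ f ⁻¹' U), ((φ.symm ⟨z, hz⟩).1 : B) = f z := fun z hz => by
    have h := hφ (φ.symm ⟨z, hz⟩)
    rw [Homeomorph.apply_symm_apply] at h
    exact h.symm
  have key₃ : ∀ (z : E) (hz : z ∈ f ⁻¹' U), f ((φ.symm ⟨z, hz⟩).2 : E) = b.1 := fun z hz => by
    have h := (φ.symm ⟨z, hz⟩).2.2
    rwa [mem_preimage, mem_singleton_iff] at h
  have hval : ∀ q : ↥(Subtype.val ⁻¹' (U ∩ O) : Set ↥O) × ↥((O.restrictPreimage f) ⁻¹' {b}),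
      f (φ (⟨q.1.1.1, q.1.2.1⟩, ⟨q.2.1.1, key₁ q.2.1 q.2.2⟩)).1 ∈ U ∩ O := fun q => by
    rw [hφ]; exact q.1.2
  refine ⟨{ toFun := fun q => ⟨⟨(φ (⟨q.1.1.1, q.1.2.1⟩, ⟨q.2.1.1, key₁ q.2.1 q.2.2⟩)).1, (hval q).2⟩,
              show f _ ∈ U ∩ O from hval q⟩
            invFun := fun x =>
              (⟨⟨(φ.symm ⟨x.1.1, x.2.1⟩).1.1, by rw [key₂]; exact x.2.2⟩, by
                  change ((φ.symm ⟨x.1.1, x.2.1⟩).1 : B) ∈ U ∩ O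
                  rw [key₂]; exact x.2⟩,
                ⟨⟨(φ.symm ⟨x.1.1, x.2.1⟩).2.1, by rw [mem_preimage, key₃]; exact b.2⟩, by
                  rw [mem_preimage, mem_singleton_iff]
                  exact Subtype.ext (key₃ _ _)⟩)
            left_inv := fun q => by
              obtain ⟨⟨⟨u, huO⟩, hu⟩, ⟨⟨e, heO⟩, he⟩⟩ := q
              simp only [Subtype.coe_eta, Homeomorph.symm_apply_apply]
            right_inv := fun x => by
              obtain ⟨⟨x, hxO⟩, hx⟩ := x
              simp only [Subtype.coe_eta, Prod.mk.eta, Homeomorph.apply_symm_apply]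
            continuous_toFun := by
              refine Continuous.subtype_mk (Continuous.subtype_mk ?_ _) _
              refine continuous_subtype_val.comp (φ.continuous.comp (Continuous.prodMk ?_ ?_))
              · exact ((continuous_subtype_val.comp continuous_subtype_val).comp continuous_fst).subtype_mk _
              · exact ((continuous_subtype_val.comp continuous_subtype_val).comp continuous_snd).subtype_mk _
            continuous_invFun := by
              have hc : Continuous fun x : ↥((O.restrictPreimage f) ⁻¹' (Subtype.val ⁻¹' (U ∩ O))) =>
                  φ.symm ⟨x.1.1, x.2.1⟩ :=
                φ.symm.continuous.comp ((continuous_subtype_val.comp continuous_subtype_val).subtype_mk _)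
              refine Continuous.prodMk ?_ ?_
              · exact (((continuous_subtype_val.comp (continuous_fst.comp hc)).subtype_mk _).subtype_mk _)
              · exact (((continuous_subtype_val.comp (continuous_snd.comp hc)).subtype_mk _).subtype_mk _) },
    fun q => ?_⟩
  apply Subtype.ext
  exact hφ _

/-- **Transport along homeomorphisms**: if `f' : E' → B'` is a locally trivial fibration and
`α : E ≃ₜ E'`, `β : B ≃ₜ B'` satisfy `f' ∘ α = β ∘ f`, then `f` is a locally trivial fibration.
[folklore] -/
theorem IsLocallyTrivialFibration.of_homeomorph {E' : Type*} {B' : Type*} [TopologicalSpace E']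
    [TopologicalSpace B'] {f : E → B} {f' : E' → B'} (hf' : IsLocallyTrivialFibration f')
    (α : E ≃ₜ E') (β : B ≃ₜ B') (hcomm : ∀ x, f' (α x) = β (f x)) :
    IsLocallyTrivialFibration f := by
  intro b
  obtain ⟨U', hU'o, hbU', φ, hφ⟩ := hf' (β b)
  refine ⟨β ⁻¹' U', hU'o.preimage β.continuous, hbU', ?_⟩
  have hf'symm : ∀ x' : E', f (α.symm x') = β.symm (f' x') := fun x' => by
    rw [← β.symm_apply_apply (f (α.symm x')), ← hcomm, Homeomorph.apply_symm_apply]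
  refine ⟨{ toFun := fun q => ⟨α.symm (φ (⟨β q.1.1, q.1.2⟩, ⟨α q.2.1, by
                have h := q.2.2
                rw [mem_preimage, mem_singleton_iff] at h ⊢
                rw [hcomm, h]⟩)).1, by
                rw [mem_preimage, hf'symm, hφ]
                change β.symm (β q.1.1) ∈ β ⁻¹' U'
                rw [β.symm_apply_apply]; exact q.1.2⟩
            invFun := fun x => (⟨β.symm (φ.symm ⟨α x.1, by
                change f' (α x.1) ∈ U'; rw [hcomm]; exact x.2⟩).1.1, by
                rw [mem_preimage, Homeomorph.apply_symm_apply]; exact (φ.symm _).1.2⟩,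
              ⟨α.symm (φ.symm ⟨α x.1, by change f' (α x.1) ∈ U'; rw [hcomm]; exact x.2⟩).2.1, by
                rw [mem_preimage, mem_singleton_iff, hf'symm]
                have h := (φ.symm ⟨α x.1, by change f' (α x.1) ∈ U'; rw [hcomm]; exact x.2⟩).2.2
                rw [mem_preimage, mem_singleton_iff] at h
                rw [h, β.symm_apply_apply]⟩)
            left_inv := fun q => by
              obtain ⟨⟨u, hu⟩, ⟨e, he⟩⟩ := q
              simp only [Homeomorph.apply_symm_apply, Subtype.coe_eta, Homeomorph.symm_apply_apply]
            right_inv := fun x => by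
              obtain ⟨x, hx⟩ := x
              simp only [Homeomorph.apply_symm_apply, Subtype.coe_eta, Prod.mk.eta,
                Homeomorph.symm_apply_apply]
            continuous_toFun := by
              refine Continuous.subtype_mk (α.symm.continuous.comp (continuous_subtype_val.comp
                (φ.continuous.comp (Continuous.prodMk ?_ ?_)))) _
              · exact (β.continuous.comp (continuous_subtype_val.comp continuous_fst)).subtype_mk _
              · exact (α.continuous.comp (continuous_subtype_val.comp continuous_snd)).subtype_mk _
            continuous_invFun := by
              have hc : Continuous fun x : ↥(f ⁻¹' (β ⁻¹' U')) => φ.symm ⟨α x.1, by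
                  change f' (α x.1) ∈ U'; rw [hcomm]; exact x.2⟩ :=
                φ.symm.continuous.comp ((α.continuous.comp continuous_subtype_val).subtype_mk _)
              refine Continuous.prodMk ?_ ?_
              · exact (β.symm.continuous.comp (continuous_subtype_val.comp (continuous_fst.comp hc))).subtype_mk _
              · exact (α.symm.continuous.comp (continuous_subtype_val.comp (continuous_snd.comp hc))).subtype_mk _ },
    fun q => ?_⟩
  change f (α.symm _) = _
  rw [hf'symm, hφ]
  exact β.symm_apply_apply _

end Literature.AlgebraicTopology.Homotopy

end
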